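import Mathlib
import Literature.MathematicalPhysics.QuantumLattice.HubbardOneParticleCost
import Literature.MathematicalPhysics.QuantumLattice.HubbardRingPerronFrobeniusProofs
import Literature.MathematicalPhysics.QuantumLattice.HubbardModel
import HarnessLib

/-!
# Crux `WcbcsSsbToTorusLRO` (stmt-HubbardSuperconductivity-2009), line `off-zero-mode-moment-closure`:
# stub F3 `stub_twoParticleCost` — the two-particle (pair) cost of the `S^z = 0` sector energies (proved)

Along even sides `L = 2k + 2` write `H = hubbardTorus 2 L 1 U`, `E(M) = minEnergyOn H (szSector M 0)`
and `N_L = 2 ⌊(1 - δ) L² / 2⌋` (`δ ∈ (0, 1/2)`, so the density lies in `(1/2, 1)`). Then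
`|E(N_L) - E(N_L - 2)| ≤ B` and `|E(N_L + 2) - E(N_L)| ≤ B` eventually in `k`, with the explicit
`B = 16 · 18 (2 + |U|)` depending on `U` only. Proof:

* `SU(2)`: for even `M = 2m ≤ 2|Λ|` the sector energy `E(2m)` is the full `2m`-particle ground energy
  `groundEnergyAt G 1 U (2m)` of the torus graph `G` (`groundEnergyAt_eq_minEnergyOn_szSector`);
* the one-particle cost on a graph of maximal degree `≤ Δ` (`HubbardOneParticleCost`):
  `E_G(M+1) ≤ E_G(M) + K · 2|Λ|/(2|Λ| - M)` and `E_G(M-1) ≤ E_G(M) + K · 2|Λ|/M`, `K = 2(2Δ+1)(2|t|+|U|)`,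
  applied twice in each direction (`tpc_abs_groundEnergyAt_add_two_sub_le`): if `M + 1 ≤ |Λ| ≤ 4(M + 1)`
  the particle weights are `≤ 2` and the hole weights `≤ 8`, so `|E_G(M+2) - E_G(M)| ≤ 16 K`;
* on the torus `(ℤ/Lℤ)²` the degree is `≤ 4` (`SourceGas.card_filter_fermionTorusGraph_adj_le`),
  `|Λ| = L²`, and for `L ≥ 4` the summit number `n = ⌊(1 - δ) L²/2⌋` satisfies `2n < L² < 4n + 4`
  (`Nat.floor_le`, `Nat.lt_floor_add_one`), which gives the two window conditions at `M = 2n - 2` and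
  `M = 2n`.

Everything is folklore bookkeeping over the tree's proved lemmas; no definition and no named fact is
introduced.
-/

noncomputable section

set_option linter.dupNamespace false

namespace Summit.HubbardSuperconductivity.HubbardSuperconductivity.Theorems.WcbcsSsbToTorusLRO

open Literature.MathematicalPhysics.QuantumLattice Literature.Probability.LatticeModels Matrix Filter
open Literature.MathematicalPhysics.QuantumLattice.ThermodynamicLimit
  (groundEnergyAt_succ_le groundEnergyAt_pred_le)

/-! ## §1 Two one-particle steps on a general graph -/

section General

variable {Λ : Type*} [LinearOrder Λ] [Fintype Λ] (G : SimpleGraph Λ) [DecidableRel G.Adj]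

/-- Weight bookkeeping: `K a / b ≤ c K` if `0 ≤ K`, `0 < b` and `a ≤ c b`. [folklore] -/
theorem tpc_weight_le {K a b c : ℝ} (hK : 0 ≤ K) (hb : 0 < b) (h : a ≤ c * b) :
    K * a / b ≤ c * K := by
  rw [div_le_iff₀ hb]
  calc K * a ≤ K * (c * b) := mul_le_mul_of_nonneg_left h hK
    _ = c * K * b := by ring

/-- **The two-particle cost on a graph of maximal degree `≤ Δ`.** If `M + 1 ≤ |Λ| ≤ 4 (M + 1)` then
`|E_G(M + 2) - E_G(M)| ≤ 16 K`, `K = 2(2Δ+1)(2|t| + |U|)`: two addition steps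
(`groundEnergyAt_succ_le` at `M`, `M + 1`, weights `2|Λ|/(2|Λ| - M), 2|Λ|/(2|Λ| - M - 1) ≤ 2`) and two
removal steps (`groundEnergyAt_pred_le` at `M + 2`, `M + 1`, weights `2|Λ|/(M + 2), 2|Λ|/(M + 1) ≤ 8`).
[folklore] -/
theorem tpc_abs_groundEnergyAt_add_two_sub_le {Δ : ℕ}
    (hΔ : ∀ x : Λ, (Finset.univ.filter fun y => G.Adj x y).card ≤ Δ) (t U : ℝ) {M : ℕ}
    (h1 : M + 1 ≤ Fintype.card Λ) (h2 : Fintype.card Λ ≤ 4 * (M + 1)) :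
    |groundEnergyAt G t U (M + 2) - groundEnergyAt G t U M| ≤
      16 * ((2 * Δ + 1 : ℕ) * (2 * (2 * |t| + |U|))) := by
  have hC1 : (M : ℝ) + 1 ≤ (Fintype.card Λ : ℝ) := by exact_mod_cast h1
  have hC2 : (Fintype.card Λ : ℝ) ≤ 4 * ((M : ℝ) + 1) := by exact_mod_cast h2
  -- the four one-particle steps
  have hu1 := groundEnergyAt_succ_le G hΔ t U (N := M) (by omega)
  have hu2 := groundEnergyAt_succ_le G hΔ t U (N := M + 1) (by omega)
  have hd1 := groundEnergyAt_pred_le G hΔ t U (N := M + 1 + 1) (by omega) (by omega)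
  have hd2 := groundEnergyAt_pred_le G hΔ t U (N := M + 1) (by omega) (by omega)
  rw [Nat.add_sub_cancel] at hd1 hd2
  have e : groundEnergyAt G t U (M + 2) = groundEnergyAt G t U (M + 1 + 1) := rfl
  rw [e]
  push_cast at hu1 hu2 hd1 hd2 ⊢
  set K : ℝ := (2 * (Δ : ℝ) + 1) * (2 * (2 * |t| + |U|)) with hK
  have hK0 : 0 ≤ K := by positivity
  set C : ℝ := (Fintype.card Λ : ℝ) with hC
  -- the four weights
  have w1 : K * (2 * C) / (2 * C - M) ≤ 2 * K :=
    tpc_weight_le hK0 (by linarith) (by linarith)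
  have w2 : K * (2 * C) / (2 * C - (M + 1)) ≤ 2 * K :=
    tpc_weight_le hK0 (by linarith) (by linarith)
  have w3 : K * (2 * C) / (M + 1 + 1) ≤ 8 * K :=
    tpc_weight_le hK0 (by positivity) (by linarith)
  have w4 : K * (2 * C) / (M + 1) ≤ 8 * K :=
    tpc_weight_le hK0 (by positivity) (by linarith)
  rw [abs_sub_le_iff]
  constructor
  · linarith
  · linarith

end General

/-! ## §2 The torus at the summit filling -/

/-- **The two-particle cost at the summit filling on the torus of side `L ≥ 4`.** With
`n = ⌊(1 - δ) L²/2⌋`, `δ ∈ (0, 1/2)`, `E(M) = minEnergyOn (hubbardTorus 2 L 1 U) (szSector M 0)`: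
`|E(2n) - E(2n - 2)|, |E(2n + 2) - E(2n)| ≤ 16 · 18 (2 + |U|)` (written as `16 K`, `K` the one-particle
cost constant at degree `4`, hopping `1`). [folklore] -/
theorem tpc_torus_summit (U δ : ℝ) (hδ : δ ∈ Set.Ioo (0:ℝ) (1 / 2)) (L : ℕ) (hL : 4 ≤ L) :
    |(hubbardTorus 2 L 1 U).minEnergyOn (szSector (2 * ⌊(1 - δ) * ((L : ℕ) : ℝ) ^ 2 / 2⌋₊) 0) -
        (hubbardTorus 2 L 1 U).minEnergyOn
          (szSector (2 * ⌊(1 - δ) * ((L : ℕ) : ℝ) ^ 2 / 2⌋₊ - 2) 0)| ≤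
        16 * (((2 * 4 + 1 : ℕ) : ℝ) * (2 * (2 * |(1 : ℝ)| + |U|))) ∧
      |(hubbardTorus 2 L 1 U).minEnergyOn
            (szSector (2 * ⌊(1 - δ) * ((L : ℕ) : ℝ) ^ 2 / 2⌋₊ + 2) 0) -
          (hubbardTorus 2 L 1 U).minEnergyOn
            (szSector (2 * ⌊(1 - δ) * ((L : ℕ) : ℝ) ^ 2 / 2⌋₊) 0)| ≤
        16 * (((2 * 4 + 1 : ℕ) : ℝ) * (2 * (2 * |(1 : ℝ)| + |U|))) := by
  haveI : NeZero L := ⟨by omega⟩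
  obtain ⟨hδ0, hδ1⟩ := hδ
  -- the torus graph: `L²` sites, degree `≤ 4`
  have hc : Fintype.card (FermionTorus 2 L) = L ^ 2 := by
    simp [FermionTorus, Fintype.card_lex]
  have hΔ : ∀ x : FermionTorus 2 L,
      (Finset.univ.filter fun y => (fermionTorusGraph 2 L).Adj x y).card ≤ 4 :=
    fun x => SourceGas.card_filter_fermionTorusGraph_adj_le x
  -- the summit number `n`: `2n < L² < 4n + 4`
  set n : ℕ := ⌊(1 - δ) * ((L : ℕ) : ℝ) ^ 2 / 2⌋₊ with hn
  have hLr : (4 : ℝ) ≤ (L : ℝ) := by exact_mod_cast hL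
  have hL2 : (16 : ℝ) ≤ (L : ℝ) ^ 2 := by nlinarith
  have hL2pos : (0 : ℝ) < (L : ℝ) ^ 2 := by linarith
  have hx0 : (0 : ℝ) ≤ (1 - δ) * (L : ℝ) ^ 2 / 2 :=
    div_nonneg (mul_nonneg (by linarith) hL2pos.le) (by norm_num)
  have hnx : (n : ℝ) ≤ (1 - δ) * (L : ℝ) ^ 2 / 2 := Nat.floor_le hx0
  have hxn : (1 - δ) * (L : ℝ) ^ 2 / 2 < n + 1 := Nat.lt_floor_add_one _
  have hA : 2 * n < L ^ 2 := by
    have h : (2 * n : ℝ) < (L : ℝ) ^ 2 := by nlinarith [mul_pos hδ0 hL2pos]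
    exact_mod_cast h
  have hB : L ^ 2 < 4 * n + 4 := by
    have h : (L : ℝ) ^ 2 < 4 * n + 4 := by
      nlinarith [mul_pos (show (0 : ℝ) < 1 / 2 - δ by linarith) hL2pos]
    exact_mod_cast h
  have hD : 16 ≤ L ^ 2 := by nlinarith
  -- `SU(2)`: the three sector energies are full ground energies
  have e0 : (hubbardTorus 2 L 1 U).minEnergyOn (szSector (2 * n) 0) =
      groundEnergyAt (fermionTorusGraph 2 L) 1 U (2 * n) :=
    (groundEnergyAt_eq_minEnergyOn_szSector (fermionTorusGraph 2 L) 1 U (by rw [hc]; omega)).symm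
  have em : (hubbardTorus 2 L 1 U).minEnergyOn (szSector (2 * n - 2) 0) =
      groundEnergyAt (fermionTorusGraph 2 L) 1 U (2 * (n - 1)) := by
    rw [show 2 * n - 2 = 2 * (n - 1) by omega]
    exact (groundEnergyAt_eq_minEnergyOn_szSector (fermionTorusGraph 2 L) 1 U
      (by rw [hc]; omega)).symm
  have ep : (hubbardTorus 2 L 1 U).minEnergyOn (szSector (2 * n + 2) 0) =
      groundEnergyAt (fermionTorusGraph 2 L) 1 U (2 * (n + 1)) := by
    rw [show 2 * n + 2 = 2 * (n + 1) by ring]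
    exact (groundEnergyAt_eq_minEnergyOn_szSector (fermionTorusGraph 2 L) 1 U
      (by rw [hc]; omega)).symm
  rw [e0, em, ep]
  -- the two windows `M = 2n - 2` and `M = 2n`
  have km := tpc_abs_groundEnergyAt_add_two_sub_le (fermionTorusGraph 2 L) hΔ 1 U
    (M := 2 * (n - 1)) (by rw [hc]; omega) (by rw [hc]; omega)
  have kp := tpc_abs_groundEnergyAt_add_two_sub_le (fermionTorusGraph 2 L) hΔ 1 U
    (M := 2 * n) (by rw [hc]; omega) (by rw [hc]; omega)
  rw [show 2 * (n - 1) + 2 = 2 * n by omega] at km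
  rw [show 2 * n + 2 = 2 * (n + 1) by ring] at kp
  exact ⟨km, kp⟩

/-! ## §3 The registered stub -/

/-- **Stub F3 — `stub_twoParticleCost`.** Along even sides `L = 2k + 2` the `S^z = 0` sector ground
energies of `H = hubbardTorus 2 L 1 U` at the summit filling `N_L = 2⌊(1 - δ)L²/2⌋` (`δ ∈ (0, 1/2)`)
change by `O(1)`, uniformly in `L`, when a pair is added or removed:
`|E(N_L) - E(N_L - 2)| ≤ B` and `|E(N_L + 2) - E(N_L)| ≤ B` eventually, `E(M) = minEnergyOn H (szSector M 0)`,
with `B = 16 · 18 (2 + |U|)` (`groundEnergyAt_succ_le`/`pred_le` twice and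
`groundEnergyAt_eq_minEnergyOn_szSector`; `tpc_torus_summit` from `L = 4` on). [folklore] -/
theorem stub_twoParticleCost :
    ∀ (U δ : ℝ), δ ∈ Set.Ioo (0:ℝ) (1 / 2) → ∃ B : ℝ, 0 ≤ B ∧ ∀ᶠ k : ℕ in Filter.atTop, |(hubbardTorus 2 (2 * k + 1 + 1) 1 U).minEnergyOn (szSector (2 * ⌊(1 - δ) * ((2 * k + 1 + 1 : ℕ) : ℝ) ^ 2 / 2⌋₊) 0) - (hubbardTorus 2 (2 * k + 1 + 1) 1 U).minEnergyOn (szSector (2 * ⌊(1 - δ) * ((2 * k + 1 + 1 : ℕ) : ℝ) ^ 2 / 2⌋₊ - 2) 0)| ≤ B ∧ |(hubbardTorus 2 (2 * k + 1 + 1) 1 U).minEnergyOn (szSector (2 * ⌊(1 - δ) * ((2 * k + 1 + 1 : ℕ) : ℝ) ^ 2 / 2⌋₊ + 2) 0) - (hubbardTorus 2 (2 * k + 1 + 1) 1 U).minEnergyOn (szSector (2 * ⌊(1 - δ) * ((2 * k + 1 + 1 : ℕ) : ℝ) ^ 2 / 2⌋₊) 0)| ≤ B := by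
  intro U δ hδ
  refine ⟨16 * (((2 * 4 + 1 : ℕ) : ℝ) * (2 * (2 * |(1 : ℝ)| + |U|))), by positivity, ?_⟩
  filter_upwards [Filter.eventually_ge_atTop 1] with k hk
  exact tpc_torus_summit U δ hδ (2 * k + 1 + 1) (by omega)

end Summit.HubbardSuperconductivity.HubbardSuperconductivity.Theorems.WcbcsSsbToTorusLRO

end
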